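import Summits.CriticalPhenomena.PercolationContinuityZ3.Theorems.PercNearOneGluingNoHeavyLowerTailCILCutObserverSteinerTools
import HarnessLib

/-!
# `NoHeavyLowerTail` (stmt-CriticalPhenomena-4575) — T-form gluing across a separating witness relay: tools

Support file (prover `prim-hp-1`, hull-port / coupling line; `--supports stmt-CriticalPhenomena-4575`).  No
definitions, no named facts, no sorries.  Part 1 of 3 (tools) for `WitnessSeparated.tform_glued_of_tform`
(file `…TformWitnessSeparated`): monotonicity and counting helpers, the support-event congruence
`measureReal_congr_support`, the T-form/slack-form conversions `slack_of_tform` / `tform_of_slack`, the block geometry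
around a separating RELAY `c` read off the loop-free pairs of each side (self-contained closure arguments in the style of
prover `prim-hp-5`'s `CutObserver.SteinerPorts.Blocks`) (`reach_cut_iff`, `reach_side_iff`, `sideReach_cut_of_reach`,
`unattached_iff`): on the support event, what `c` reaches on a side it reaches inside that side, and a side vertex not
joined to `c` keeps its side cluster.  Setting and motivation: crux memo HULLPORT-COUPLING.md §28–§29 (the lead's master
gluing rule, witness-separated case).
-/

noncomputable section

namespace Summit.CriticalPhenomena.PercolationContinuityZ3.Theorems

open MeasureTheory Set Literature.Probability.LatticeModels Literature.Probability.Percolation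
open scoped Classical BigOperators

variable {n : ℕ}

namespace WitnessSeparated

open CutObserver CutObserver.SteinerPorts

/-! ### Small tools -/

/-- Reachability read off `ω ∩ F` is monotone in `ω`. [folklore] -/
theorem reach_inter_mono {ω ω' : BondConfig (Fin n)} (F : Set (Sym2 (Fin n))) (h : ω ⊆ ω') {x y : Fin n}
    (hxy : (openGraph (ω ∩ F)).Reachable x y) : (openGraph (ω' ∩ F)).Reachable x y :=
  reachable_mono (inter_subset_inter_left F h) hxy

/-- The relay count read off `ω ∩ F` is monotone in `ω`. [folklore] -/
theorem card_inter_mono (A : Finset (Fin n)) (F : Set (Sym2 (Fin n))) (x : Fin n)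
    {ω ω' : BondConfig (Fin n)} (h : ω ⊆ ω') :
    (A.filter fun a => (openGraph (ω ∩ F)).Reachable x a).card ≤
      (A.filter fun a => (openGraph (ω' ∩ F)).Reachable x a).card :=
  Finset.card_le_card fun a ha => by
    rw [Finset.mem_filter] at ha ⊢
    exact ⟨ha.1, reach_inter_mono F h ha.2⟩

/-- The relay count is monotone in `ω`. [folklore] -/
theorem card_mono (A : Finset (Fin n)) (x : Fin n) {ω ω' : BondConfig (Fin n)} (h : ω ⊆ ω') :
    (A.filter fun a => ω ∈ openConn x a).card ≤ (A.filter fun a => ω' ∈ openConn x a).card :=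
  Finset.card_le_card fun a ha => by
    rw [Finset.mem_filter] at ha ⊢
    exact ⟨ha.1, reachable_mono h ha.2⟩

/-- Joined vertices have the same relay count. [folklore] -/
theorem card_eq_of_reachable (A : Finset (Fin n)) {ω : BondConfig (Fin n)} {x y : Fin n}
    (h : (openGraph ω).Reachable x y) :
    (A.filter fun a => ω ∈ openConn x a).card = (A.filter fun a => ω ∈ openConn y a).card := by
  congr 1
  refine Finset.filter_congr fun a _ => ?_
  simp only [openConn, mem_setOf_eq]
  exact ⟨fun hxa => h.symm.trans hxa, fun hya => h.trans hya⟩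

/-- A positive relay count exhibits a reachable relay. [folklore] -/
theorem exists_of_card_pos {A : Finset (Fin n)} {p : Fin n → Prop} (h : 0 < (A.filter p).card) :
    ∃ a ∈ A, p a := by
  obtain ⟨a, ha⟩ := Finset.card_pos.1 h
  rw [Finset.mem_filter] at ha
  exact ⟨a, ha.1, ha.2⟩

/-- Every event is determined by a set of coordinates containing all of them. [folklore] -/
theorem determinedBy_of_forall_mem (X : Set (BondConfig (Fin n))) {F : Set (Sym2 (Fin n))}
    (hF : ∀ e, e ∈ F) : DeterminedBy X F := by
  rw [determinedBy_iff]
  intro ω ω' h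
  have : ω = ω' := by
    ext e
    have := Set.ext_iff.1 h e
    simp only [mem_inter_iff, hF e, and_true] at this
    exact this
  rw [this]

/-- Two events that agree on the support event have the same probability. [folklore] -/
theorem measureReal_congr_support (w : Sym2 (Fin n) → unitInterval) {X Y : Set (BondConfig (Fin n))}
    (h : ∀ ω : BondConfig (Fin n), (∀ e ∈ ω, w e ≠ 0) → (ω ∈ X ↔ ω ∈ Y)) :
    (prodBernoulli w).real X = (prodBernoulli w).real Y := by
  rw [← measureReal_inter_support w X, ← measureReal_inter_support w Y]
  congr 1
  ext ω
  simp only [mem_inter_iff, mem_setOf_eq]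
  constructor
  · rintro ⟨hX, hG⟩; exact ⟨(h ω hG).1 hX, hG⟩
  · rintro ⟨hY, hG⟩; exact ⟨(h ω hG).2 hY, hG⟩

/-- Every event is determined by the pairs of a side together with all remaining pairs. [folklore] -/
theorem determinedBy_union_compl (X : Set (BondConfig (Fin n))) (E : Finset (Sym2 (Fin n))) :
    DeterminedBy X (↑E ∪ ↑(Finset.univ \ E)) :=
  determinedBy_of_forall_mem X fun e => by
    by_cases he : e ∈ E
    · exact Or.inl he
    · exact Or.inr (Finset.mem_coe.2 (Finset.mem_sdiff.2 ⟨Finset.mem_univ e, he⟩))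

/-- An event read off `ω ∩ F` is determined by the coordinates in `F`. [folklore] -/
theorem determinedBy_readOff (F : Set (Sym2 (Fin n))) (Φ : BondConfig (Fin n) → Prop) :
    DeterminedBy {ω : BondConfig (Fin n) | Φ (ω ∩ F)} F := by
  rw [determinedBy_iff]
  intro ω ω' h
  simp only [mem_setOf_eq]
  rw [h]

/-- An event read off the loop-free pairs of one side is determined off the loop-free pairs of any other side (two sides
share no loop-free pair). [folklore] -/
theorem determinedBy_offBlock (o : Fin n) {d : ℕ} (V : Fin d → Finset (Fin n))
    (hdisj : ∀ l l', l ≠ l' → Disjoint (V l) (V l')) {i i' : Fin d} (hii' : i ≠ i')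
    {B : Set (BondConfig (Fin n))} (dB : DeterminedBy B (↑((insert o (V i')).sym2.erase s(o, o)) : Set (Sym2 (Fin n)))) :
    DeterminedBy B (↑(Finset.univ \ (insert o (V i)).sym2.erase s(o, o)) : Set (Sym2 (Fin n))) := by
  refine dB.mono fun e he => Finset.mem_coe.2 (Finset.mem_sdiff.2 ⟨Finset.mem_univ e, fun he' => ?_⟩)
  rw [Finset.mem_coe, Finset.mem_erase, Finset.mem_sym2_iff] at he
  rw [Finset.mem_erase, Finset.mem_sym2_iff] at he'
  induction e using Sym2.ind with
  | h x y =>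
    have hx := he'.2 x (Sym2.mem_mk_left x y)
    have hy := he'.2 y (Sym2.mem_mk_right x y)
    have hx' := he.2 x (Sym2.mem_mk_left x y)
    have hy' := he.2 y (Sym2.mem_mk_right x y)
    rw [Finset.mem_insert] at hx hy hx' hy'
    have hxo : x = o := by
      rcases hx with h | h
      · exact h
      · rcases hx' with h' | h'
        · exact h'
        · exact absurd h' (Finset.disjoint_left.1 (hdisj i i' hii') h)
    have hyo : y = o := by
      rcases hy with h | h
      · exact h
      · rcases hy' with h' | h'
        · exact h'
        · exact absurd h' (Finset.disjoint_left.1 (hdisj i i' hii') h)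
    exact he.1 (by rw [hxo, hyo])

/-- Adjacency read off the loop-free pairs of `insert o X`. [folklore] -/
theorem adj_side_iff (ω : BondConfig (Fin n)) (X : Finset (Fin n)) (o u v : Fin n) :
    (openGraph (ω ∩ ↑((insert o X).sym2.erase s(o, o)))).Adj u v ↔
      s(u, v) ∈ ω ∧ u ∈ insert o X ∧ v ∈ insert o X ∧ u ≠ v := by
  rw [openGraph, SimpleGraph.fromEdgeSet_adj, mem_inter_iff, Finset.mem_coe, Finset.mem_erase,
    Finset.mk_mem_sym2_iff]
  constructor
  · rintro ⟨⟨hω, -, hu, hv⟩, hne⟩; exact ⟨hω, hu, hv, hne⟩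
  · rintro ⟨hω, hu, hv, hne⟩
    refine ⟨⟨hω, fun h => ?_, hu, hv⟩, hne⟩
    rw [Sym2.eq_iff] at h
    rcases h with ⟨rfl, rfl⟩ | ⟨rfl, rfl⟩ <;> exact hne rfl

/-- Reachability read off the loop-free pairs of `insert o X` stays inside `insert o X`. [folklore] -/
theorem mem_of_reach_side {ω : BondConfig (Fin n)} {X : Finset (Fin n)} {o x y : Fin n}
    (hx : x ∈ insert o X) (h : (openGraph (ω ∩ ↑((insert o X).sym2.erase s(o, o)))).Reachable x y) :
    y ∈ insert o X :=
  mem_of_reachable_restrict hx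
    (reachable_mono (inter_subset_inter_right ω (Finset.coe_subset.2 (Finset.erase_subset _ _))) h)

/-! ### Geometry of a separating relay (pointwise, on the support event) -/

section Geometry

variable (w : Sym2 (Fin n) → unitInterval) (c : Fin n) {d : ℕ} (V : Fin d → Finset (Fin n))

/-- **What the cut relay reaches on a side, it reaches inside that side.**  On the support event, for `y ∈ V i`:
`c ↔ y` iff `c ↔ y` through the loop-free pairs of `insert c (V i)`. [folklore] -/
theorem reach_cut_iff (hcV : ∀ l, c ∉ V l) (hdisj : ∀ l l', l ≠ l' → Disjoint (V l) (V l'))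
    (hcover : ∀ x, x ≠ c → ∃ l, x ∈ V l)
    (hsep : ∀ l l', l ≠ l' → ∀ x ∈ V l, ∀ y ∈ V l', w s(x, y) = 0)
    (ω : BondConfig (Fin n)) (hG : ∀ e ∈ ω, w e ≠ 0) (i : Fin d) {y : Fin n} (hy : y ∈ V i) :
    (openGraph ω).Reachable c y ↔
      (openGraph (ω ∩ ↑((insert c (V i)).sym2.erase s(c, c)))).Reachable c y := by
  constructor
  · intro h
    -- the set of vertices reached from `c` inside their own side (or `c` itself) is closed under open adjacency
    set Q : Set (Fin n) := {v | v = c ∨ ∃ l, v ∈ V l ∧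
      (openGraph (ω ∩ ↑((insert c (V l)).sym2.erase s(c, c)))).Reachable c v} with hQ
    have hcl : ∀ u ∈ Q, ∀ v, (openGraph ω).Adj u v → v ∈ Q := by
      intro u hu v huv
      rw [openGraph, SimpleGraph.fromEdgeSet_adj] at huv
      obtain ⟨huvω, hne⟩ := huv
      by_cases hvc : v = c
      · exact Or.inl hvc
      obtain ⟨l', hvl'⟩ := hcover v hvc
      right
      rcases hu with rfl | ⟨l, hul, hreach⟩
      · refine ⟨l', hvl', SimpleGraph.Adj.reachable ?_⟩
        rw [adj_side_iff]
        exact ⟨huvω, Finset.mem_insert_self _ _, Finset.mem_insert_of_mem hvl', hne⟩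
      · have hll' : l' = l := by
          by_contra hll'
          exact hG _ huvω (by rw [Sym2.eq_swap]; exact hsep l' l hll' v hvl' u hul)
        subst hll'
        refine ⟨l', hvl', hreach.trans (SimpleGraph.Adj.reachable ?_)⟩
        rw [adj_side_iff]
        exact ⟨huvω, Finset.mem_insert_of_mem hul, Finset.mem_insert_of_mem hvl', hne⟩
    have hyQ : y ∈ Q := mem_of_reachable_of_closed _ Q hcl (Or.inl rfl) h
    rcases hyQ with hyc | ⟨l, hyl, hreach⟩
    · subst hyc
      exact absurd hy (hcV i)
    · have hli : l = i := by
        by_contra hli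
        exact Finset.disjoint_left.1 (hdisj l i hli) hyl hy
      subst hli
      exact hreach
  · exact fun h => reachable_mono inter_subset_left h

/-- **A side vertex not joined to the cut relay keeps its side cluster.**  On the support event, for `x ∈ V i` with
`¬ (x ↔ c)`: `x ↔ y` iff `x ↔ y` through the loop-free pairs of `insert c (V i)`. [folklore] -/
theorem reach_side_iff (hcover : ∀ x, x ≠ c → ∃ l, x ∈ V l)
    (hsep : ∀ l l', l ≠ l' → ∀ x ∈ V l, ∀ y ∈ V l', w s(x, y) = 0)
    (ω : BondConfig (Fin n)) (hG : ∀ e ∈ ω, w e ≠ 0) (i : Fin d)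
    {x : Fin n} (hx : x ∈ V i) (hnot : ¬ (openGraph ω).Reachable x c) (y : Fin n) :
    (openGraph ω).Reachable x y ↔
      (openGraph (ω ∩ ↑((insert c (V i)).sym2.erase s(c, c)))).Reachable x y := by
  constructor
  · intro h
    set Q : Set (Fin n) := {v | (openGraph (ω ∩ ↑((insert c (V i)).sym2.erase s(c, c)))).Reachable x v} with hQ
    have hcl : ∀ u ∈ Q, ∀ v, (openGraph ω).Adj u v → v ∈ Q := by
      intro u hu v huv
      rw [openGraph, SimpleGraph.fromEdgeSet_adj] at huv
      obtain ⟨huvω, hne⟩ := huv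
      have huB : u ∈ insert c (V i) := mem_of_reach_side (Finset.mem_insert_of_mem hx) hu
      have huc : u ≠ c := by
        rintro rfl
        exact hnot (reachable_mono inter_subset_left hu)
      have huVi : u ∈ V i := by
        rcases Finset.mem_insert.1 huB with h' | h'
        · exact absurd h' huc
        · exact h'
      have hvB : v ∈ insert c (V i) := by
        by_cases hvc : v = c
        · rw [hvc]; exact Finset.mem_insert_self _ _
        obtain ⟨l', hvl'⟩ := hcover v hvc
        have hll' : l' = i := by
          by_contra hll'
          exact hG _ huvω (by rw [Sym2.eq_swap]; exact hsep l' i hll' v hvl' u huVi)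
        subst hll'
        exact Finset.mem_insert_of_mem hvl'
      show (openGraph (ω ∩ ↑((insert c (V i)).sym2.erase s(c, c)))).Reachable x v
      refine SimpleGraph.Reachable.trans hu (SimpleGraph.Adj.reachable ?_)
      rw [adj_side_iff]
      exact ⟨huvω, huB, hvB, hne⟩
    exact mem_of_reachable_of_closed _ Q hcl (SimpleGraph.Reachable.refl x) h
  · exact fun h => reachable_mono inter_subset_left h

/-- On the support event, a side vertex joined to the cut relay is joined to it through its own side. [folklore] -/
theorem sideReach_cut_of_reach (hcV : ∀ l, c ∉ V l) (hdisj : ∀ l l', l ≠ l' → Disjoint (V l) (V l'))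
    (hcover : ∀ x, x ≠ c → ∃ l, x ∈ V l)
    (hsep : ∀ l l', l ≠ l' → ∀ x ∈ V l, ∀ y ∈ V l', w s(x, y) = 0)
    (ω : BondConfig (Fin n)) (hG : ∀ e ∈ ω, w e ≠ 0)
    (i : Fin d) {x : Fin n} (hx : x ∈ V i) (h : (openGraph ω).Reachable x c) :
    (openGraph (ω ∩ ↑((insert c (V i)).sym2.erase s(c, c)))).Reachable x c :=
  ((reach_cut_iff w c V hcV hdisj hcover hsep ω hG i hx).1 h.symm).symm

/-- On the support event, `x ∈ V i` reaches no relay iff it reaches no relay inside its side (the cut `c` being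
a relay). [folklore] -/
theorem unattached_iff (A : Finset (Fin n)) (hcA : c ∈ A) (hcV : ∀ l, c ∉ V l)
    (hdisj : ∀ l l', l ≠ l' → Disjoint (V l) (V l'))
    (hcover : ∀ x, x ≠ c → ∃ l, x ∈ V l)
    (hsep : ∀ l l', l ≠ l' → ∀ x ∈ V l, ∀ y ∈ V l', w s(x, y) = 0)
    (ω : BondConfig (Fin n)) (hG : ∀ e ∈ ω, w e ≠ 0) (i : Fin d) {x : Fin n} (hx : x ∈ V i) :
    (∀ a ∈ A, ω ∉ openConn x a) ↔
      ∀ a ∈ A, ¬ (openGraph (ω ∩ ↑((insert c (V i)).sym2.erase s(c, c)))).Reachable x a := by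
  constructor
  · intro h a ha h'
    exact h a ha (reachable_mono inter_subset_left h')
  · intro h a ha h'
    have hnot : ¬ (openGraph ω).Reachable x c :=
      fun hxc => h c hcA (sideReach_cut_of_reach w c V hcV hdisj hcover hsep ω hG i hx hxc)
    exact h a ha ((reach_side_iff w c V hcover hsep ω hG i hx hnot a).1 h')

end Geometry

end WitnessSeparated

end Summit.CriticalPhenomena.PercolationContinuityZ3.Theorems

end
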